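import Mathlib.Data.Int.ConditionallyCompleteOrder
import Mathlib.Order.ConditionallyCompleteLattice.Basic
import Literature.AlgebraicGeometry.Motives.MixedHodgeStructureBounds
import HarnessLib

/-!
# The weight filtration and the Hodge co-level filtration on a space of formal periods

Definition request `defn-HodgeColevelFiltration` (route `KontsevichZagierPeriods/HodgeColevel`,
cruxes `DegreeBound` / `DegreeEquality`; idea card `kz-degree-hodge-colevel-problem-two`).

## The notion (informal, as requested)

Let `P̃` be a space of (effective) formal periods and, for every "motive" `V` realised in it, let
`C(V) ⊆ P̃` be its **coefficient space** — the span of the formal period symbols `(V, ω, γ)`,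
`ω ∈ V_dR`, `γ ∈ V_B^∨` (the formal analogue of the space of periods `P⟨V⟩ ⊆ ℂ` of
Huber–Müller-Stach, draft III Def. 9.2.1 / Rem. 9.2.2 and Def. 9.3.1 (2); book 2017, §11.2), and
let `V_B` carry its mixed `ℚ`-Hodge structure (Deligne, *Hodge II* 2.3.1, *Hodge III* 8.2–8.3;
Huber–Müller-Stach draft III Prop. 10.4.5 for the weight filtration on Nori motives). Define the
increasing filtrations
* `W_w P̃ := Σ { C(V) : all weights of V are ≤ w }` (**weight filtration**),
* `C_c P̃ := Σ { C(V) : every Hodge type (p, q) of every Gr^W_n V has max p q ≤ c }`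
  (**Hodge co-level filtration**),

and for `x ∈ P̃` the **weight** `wt x :=` the least `w` with `x ∈ W_w` (`⊥` for `x = 0`) and the
**Hodge co-level** `hodgeColevel x :=` the least `c` with `x ∈ C_c`.

## What is defined here

Everything above is order theory over the following datum, so it is defined in that generality;
the tree's instance on the space of effective formal periods
`FreePeriodSymbols R σ ⧸ formalPeriodRelations R B σ` (Huber–Müller-Stach 2017, Def. 13.1.1) is
`HodgePeriodDatum.ofSymbols` in `HodgeColevelFiltrationSymbols.lean`.

* `HodgePeriodDatum k P ι V`: a family `ι` of objects realised in a `k`-module `P` of formal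
  periods, each with a `ℚ`-vector space `V i` carrying a mixed Hodge structure `hodge i` (its
  Hodge realisation) and a coefficient space `coeff i : Submodule k P`.
* `D.weightFiltration w`, `D.hodgeColevelFiltration c : Submodule k P` — the two sums above, as
  `⨆` over the indices satisfying `MixedHodgeStructure.WeightsLE w`, resp. `HodgeTypesLE c`
  (`MixedHodgeStructureBounds.lean`); both increasing.
* `D.weight x`, `D.hodgeColevel x : WithBot (WithTop ℤ)` — the least index of the step containing
  `x` (`⊥` iff `x` lies in every step, in particular for `x = 0`; `⊤` iff in none), through the
  helper `leastIndex` of a `ℤ`-family of submodules, with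
  `weight_le_iff : D.weight x ≤ w ↔ x ∈ D.weightFiltration w`, `hodgeColevel_le_iff`,
  `le_hodgeColevel_iff : c ≤ D.hodgeColevel x ↔ x ∉ D.hodgeColevelFiltration (c - 1)` (the form
  of the lower bounds of route `HodgeColevel`), `…_zero`, `…_eq_bot_iff`, `…_eq_top_iff`,
  sub-additivity `…_add_le` and `…_smul_le`.

## Design notes

* Values in `WithBot (WithTop ℤ) = ℤ ∪ {±∞}` (Mathlib's complete linear order
  `WithBot.WithTop.completeLinearOrder`, the pattern of `EReal`), exactly as `Polynomial.degree`
  takes values in `WithBot ℕ`: the request asks for `wt 0 = ⊥`, and over an abstract datum an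
  element need not lie in any step (`⊤`; on effective formal periods the weight is never `⊤` and
  the co-level is not `⊤` once every vertex has bounded types, see the `…Symbols` file).
  Integers are compared through `(n : WithTop ℤ)`.
* Indexing by `ℤ` follows the tree's `MixedHodgeStructure` (`W : ℤ → _`, pieces `(p, q) ∈ ℤ²`);
  for effective data only `w, c ≥ 0` matter, and a route reading "`hodgeColevel (Ψ r) ≤ deg r`"
  is `D.hodgeColevel x ≤ ((deg r : ℤ) : WithTop ℤ)`, equivalently (`hodgeColevel_le_iff`)
  `x ∈ D.hodgeColevelFiltration (deg r)`.
* The index family is a parameter: vertices `Hⁱ(X, D)` of the diagram of effective pairs in the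
  `…Symbols` file; all Nori motives (sub-quotients of sums of vertices), which the tree does not
  have, would be another value — for a sub-quotient `V` of `H = Hⁱ(X, D)` one has `C(V) ⊆ C(H)`,
  so vertex-indexed filtrations are contained in the motive-indexed ones of the request, and the
  route's `DegreeBound` schema (an `m`-dimensional representation is a period of `Hᵐ(X, D)`,
  `dim X = m`, whose Hodge types lie in `[0, m]²`) only uses vertices.
* Mathlib: no Hodge structures, formal periods, or "least index of a filtration containing `x`"
  (`lean search colevel|coniveau|weightFiltration|leastIndex`: nothing relevant).

## What is NOT here (recorded for the planner)

* The comodule / torsor structure of `P̃⁺` ("sub-bicomodule"), the product, and the requested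
  companion facts (F1) weights/types of `Hᵐ(X, D)` (Deligne, Hodge III, 8.2.4, 8.3.9 — a property
  of the Hodge datum of pairs, `MixedHodgeStructureOfPair`), (F2) strictness / Jordan–Hölder
  reading of `x ∈ C_c`, (F3) grading on the pure part, (F4) values of `W_0`: statements about the
  classical instance / Nori motives, not honest `Prop`s over an arbitrary datum; left to facts.

## References

* P. Deligne, *Théorie de Hodge II* (1971), 2.3.1, 2.3.5; *Théorie de Hodge III* (1974), 8.2–8.3.
* A. Huber, S. Müller-Stach, *Periods and Nori Motives*, Springer 2017, Def. 13.1.1, §11.2;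
  draft of Part III (2015), Def. 9.2.1, Rem. 9.2.2, Def. 9.3.1, Prop. 10.4.5, Def. 12.1.1.
* M. Kontsevich, D. Zagier, *Periods* (2001), §1.2 Problem 2; J. Wan, *Degrees of periods*,
  arXiv:1102.2273 (the value-level degree the co-level is meant to bound).
-/

noncomputable section

namespace Literature.AlgebraicGeometry.Motives

universe u v u₁ u₂

/-! ### The least index of a `ℤ`-filtration containing an element -/

section LeastIndex

variable {k : Type u₁} [Semiring k] {P : Type u₂} [AddCommMonoid P] [Module k P]

/-- For a `ℤ`-indexed family `S` of submodules of `P` and `x : P`, the **least index** `n` with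
`x ∈ S n`, as an element of `WithBot (WithTop ℤ) = ℤ ∪ {±∞}`: the infimum of the `n` with
`x ∈ S n`, hence `⊥` when `x` lies in every `S n` (e.g. `x = 0`) and `⊤` when `x` lies in no
`S n`. For a monotone `S`, `leastIndex S x ≤ n ↔ x ∈ S n` (`leastIndex_le_coe_iff`). The common
shape of the weight and of the Hodge co-level of a formal period. [folklore] -/
def leastIndex (S : ℤ → Submodule k P) (x : P) : WithBot (WithTop ℤ) :=
  ⨅ (n : ℤ) (_ : x ∈ S n), ((n : WithTop ℤ) : WithBot (WithTop ℤ))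

variable {S : ℤ → Submodule k P} {x y : P}

/-- `x ∈ S n` bounds the least index by `n`. [folklore] -/
theorem leastIndex_le_of_mem {n : ℤ} (h : x ∈ S n) : leastIndex S x ≤ (n : WithTop ℤ) :=
  iInf₂_le n h

/-- In `ℤ ∪ {±∞}`, only `⊥` lies below every integer. [folklore] -/
theorem extInt_eq_bot_of_forall_le_coe {a : WithBot (WithTop ℤ)}
    (h : ∀ n : ℤ, a ≤ (n : WithTop ℤ)) : a = ⊥ := by
  induction a using WithBot.recBotCoe with
  | bot => rfl
  | coe a =>
    exfalso
    induction a using WithTop.recTopCoe with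
    | top => exact not_le.2 (WithBot.coe_lt_coe.2 (WithTop.coe_lt_top (0 : ℤ))) (h 0)
    | coe z =>
      have := WithTop.coe_le_coe.1 (WithBot.coe_le_coe.1 (h (z - 1)))
      omega

/-- For a **monotone** family, the least index is `≤ n` exactly when `x ∈ S n`. [folklore] -/
theorem leastIndex_le_coe_iff (hS : Monotone S) {n : ℤ} :
    leastIndex S x ≤ (n : WithTop ℤ) ↔ x ∈ S n := by
  refine ⟨fun h => ?_, leastIndex_le_of_mem⟩
  by_contra hx
  have h' : (((n + 1 : ℤ) : WithTop ℤ) : WithBot (WithTop ℤ)) ≤ leastIndex S x := by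
    refine le_iInf₂ fun m hm => WithBot.coe_le_coe.2 (WithTop.coe_le_coe.2 ?_)
    by_contra hnm
    exact hx (hS (show m ≤ n by omega) hm)
  have := WithTop.coe_le_coe.1 (WithBot.coe_le_coe.1 (h'.trans h))
  omega

/-- Integers are discrete in `ℤ ∪ {±∞}`: `n ≤ a ↔ n - 1 < a`. [folklore] -/
theorem extInt_coe_le_iff_pred_lt {a : WithBot (WithTop ℤ)} {n : ℤ} :
    ((n : WithTop ℤ) : WithBot (WithTop ℤ)) ≤ a ↔
      (((n - 1 : ℤ) : WithTop ℤ) : WithBot (WithTop ℤ)) < a := by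
  induction a using WithBot.recBotCoe with
  | bot => simp
  | coe a =>
    induction a using WithTop.recTopCoe with
    | top => exact iff_of_true (WithBot.coe_le_coe.2 le_top) (WithBot.coe_lt_coe.2 (WithTop.coe_lt_top _))
    | coe z =>
      simp only [WithBot.coe_le_coe, WithBot.coe_lt_coe, WithTop.coe_le_coe, WithTop.coe_lt_coe]
      omega

/-- For a monotone family, `n ≤ leastIndex S x` exactly when `x ∉ S (n - 1)`. [folklore] -/
theorem coe_le_leastIndex_iff (hS : Monotone S) {n : ℤ} :
    ((n : WithTop ℤ) : WithBot (WithTop ℤ)) ≤ leastIndex S x ↔ x ∉ S (n - 1) := by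
  rw [extInt_coe_le_iff_pred_lt, ← leastIndex_le_coe_iff hS, not_le]

/-- For a monotone family, the least index equals `n` exactly when `x ∈ S n` and
`x ∉ S (n - 1)`. [folklore] -/
theorem leastIndex_eq_coe_iff (hS : Monotone S) {n : ℤ} :
    leastIndex S x = (n : WithTop ℤ) ↔ x ∈ S n ∧ x ∉ S (n - 1) :=
  le_antisymm_iff.trans (and_congr (leastIndex_le_coe_iff hS) (coe_le_leastIndex_iff hS))

/-- The least index is `⊥` exactly when `x` lies in every step (for a monotone family). [folklore] -/
theorem leastIndex_eq_bot_iff (hS : Monotone S) : leastIndex S x = ⊥ ↔ ∀ n, x ∈ S n := by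
  refine ⟨fun h n => (leastIndex_le_coe_iff hS).1 (h.le.trans bot_le), fun h => ?_⟩
  exact extInt_eq_bot_of_forall_le_coe fun n => leastIndex_le_of_mem (h n)

/-- `0` lies in every step, so its least index is `⊥`. [folklore] -/
@[simp]
theorem leastIndex_zero : leastIndex S (0 : P) = ⊥ :=
  extInt_eq_bot_of_forall_le_coe fun n => leastIndex_le_of_mem (S n).zero_mem

/-- The least index is `⊤` exactly when `x` lies in no step. [folklore] -/
theorem leastIndex_eq_top_iff : leastIndex S x = ⊤ ↔ ∀ n, x ∉ S n := by
  constructor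
  · intro h n hn
    have := (leastIndex_le_of_mem hn).trans_lt (WithBot.coe_lt_coe.2 (WithTop.coe_lt_top n))
    exact this.ne h
  · intro h
    exact top_unique (le_iInf₂ fun n hn => (h n hn).elim)

/-- Scalar multiples do not raise the least index. [folklore] -/
theorem leastIndex_smul_le (a : k) : leastIndex S (a • x) ≤ leastIndex S x :=
  le_iInf₂ fun n hn => leastIndex_le_of_mem ((S n).smul_mem a hn)

/-- **Sub-additivity**: for a monotone family, the least index of a sum is at most the larger of
the two least indices (each step is a submodule). [folklore] -/
theorem leastIndex_add_le (hS : Monotone S) :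
    leastIndex S (x + y) ≤ max (leastIndex S x) (leastIndex S y) := by
  -- it suffices to bound by every integer step containing both summands
  rcases le_total (leastIndex S x) (leastIndex S y) with hxy | hxy
  · rw [max_eq_right hxy]
    refine le_iInf₂ fun n hn => leastIndex_le_of_mem ((S n).add_mem ?_ hn)
    exact (leastIndex_le_coe_iff hS).1 (hxy.trans (leastIndex_le_of_mem hn))
  · rw [max_eq_left hxy]
    refine le_iInf₂ fun n hn => leastIndex_le_of_mem ((S n).add_mem hn ?_)
    exact (leastIndex_le_coe_iff hS).1 (hxy.trans (leastIndex_le_of_mem hn))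

end LeastIndex

/-! ### Period data with Hodge realisations; the two filtrations -/

/-- A **period datum with Hodge realisations**: a family `ι` of objects ("motives") realised in
a `k`-module `P` of formal periods, each object `i` coming with a `ℚ`-vector space `V i` carrying
a mixed `ℚ`-Hodge structure `hodge i` (its Hodge realisation `V_B`; Deligne, Hodge II, 2.3.1) and
with its **coefficient space** `coeff i ⊆ P` — intended: the span of the formal period symbols
`(V, ω, γ)`, `ω ∈ V_dR`, `γ ∈ V_B^∨`, the formal analogue of Huber–Müller-Stach's space of
periods `P⟨V⟩` (draft III, Def. 9.2.1, Rem. 9.2.2, Def. 9.3.1 (2)). Only these data enter the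
weight and Hodge co-level filtrations; the index type `ι` and the carriers `V` are parameters.
The tree's instance is `HodgePeriodDatum.ofSymbols` (file `HodgeColevelFiltrationSymbols.lean`:
vertices `Hⁱ(X, D)` of the diagram of effective pairs, realised in the space of effective formal
periods of Huber–Müller-Stach 2017, Def. 13.1.1). [cite: HuberMullerStachPeriodsIII2015, Def. 9.2.1, Rem. 9.2.2, Def. 9.3.1] -/
structure HodgePeriodDatum (k : Type u₁) [Semiring k] (P : Type u₂) [AddCommMonoid P] [Module k P]
    (ι : Type u) (V : ι → Type v) [∀ i, AddCommGroup (V i)] [∀ i, Module ℚ (V i)] where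
  /-- The mixed Hodge structure on `V i` (the Hodge realisation of the object `i`). -/
  hodge : ∀ i, MixedHodgeStructure (V i)
  /-- The coefficient space `C(i) ⊆ P` of the object `i` (span of its formal period symbols). -/
  coeff : ι → Submodule k P

namespace HodgePeriodDatum

variable {k : Type u₁} [Semiring k] {P : Type u₂} [AddCommMonoid P] [Module k P]
variable {ι : Type u} {V : ι → Type v} [∀ i, AddCommGroup (V i)] [∀ i, Module ℚ (V i)]
variable (D : HodgePeriodDatum k P ι V)

/-- The **weight filtration** `W_w P := Σ { C(i) : all weights of i are ≤ w }` of the space of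
formal periods: the sum of the coefficient spaces of the objects whose Hodge realisation has
`W_w = V`, i.e. all weights `≤ w` (weights of Nori motives / of their Hodge realisations:
Huber–Müller-Stach draft III, Prop. 10.4.5; Deligne, Hodge II, 2.3.1). Increasing in `w`
(`monotone_weightFiltration`). [folklore] -/
def weightFiltration (w : ℤ) : Submodule k P :=
  ⨆ (i : ι) (_ : (D.hodge i).WeightsLE w), D.coeff i

/-- The **Hodge co-level filtration** `C_c P := Σ { C(i) : every Hodge type (p, q) of every
graded piece Gr^W_n of i has max p q ≤ c }`: the sum of the coefficient spaces of the objects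
whose Hodge types lie in the box `(-∞, c]²` (`[0, c]²` for effective ones). Increasing in `c`
(`monotone_hodgeColevelFiltration`). This is the notion requested by route `HodgeColevel`
(card `kz-degree-hodge-colevel-problem-two`): an `m`-dimensional integral representation is a
period of `Hᵐ(X, D)`, `dim X = m`, whose types lie in `[0, m]²` (Deligne, Hodge III, 8.2.4,
8.3.9), hence its symbol lies in `C_m`. [folklore] -/
def hodgeColevelFiltration (c : ℤ) : Submodule k P :=
  ⨆ (i : ι) (_ : (D.hodge i).HodgeTypesLE c), D.coeff i

/-- The **weight** of a formal period `x`: the least `w` with `x ∈ W_w P`, in `ℤ ∪ {±∞}`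
(`⊥` for `x = 0` and more generally iff `x` lies in every `W_w`; `⊤` iff `x` lies in no `W_w`,
which does not happen for effective formal periods: `weight_ofSymbols_ne_top` in the `…Symbols`
file). The planner's `wt x`. [folklore] -/
def weight (x : P) : WithBot (WithTop ℤ) :=
  leastIndex D.weightFiltration x

/-- The **Hodge co-level** of a formal period `x`: the least `c` with `x ∈ C_c P`, in `ℤ ∪ {±∞}`
(`⊥` for `x = 0`; `⊤` iff `x` lies in no `C_c`). Route `HodgeColevel`'s `DegreeBound` reads
`D.hodgeColevel (Ψ r) ≤ deg_KZ r`, i.e. (`hodgeColevel_le_iff`) `Ψ r ∈ C_{deg r}`. [folklore] -/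
def hodgeColevel (x : P) : WithBot (WithTop ℤ) :=
  leastIndex D.hodgeColevelFiltration x

/-! #### API -/

/-- Unfolding the weight filtration. [folklore] -/
theorem weightFiltration_def (w : ℤ) :
    D.weightFiltration w = ⨆ (i : ι) (_ : (D.hodge i).WeightsLE w), D.coeff i :=
  rfl

/-- Unfolding the Hodge co-level filtration. [folklore] -/
theorem hodgeColevelFiltration_def (c : ℤ) :
    D.hodgeColevelFiltration c = ⨆ (i : ι) (_ : (D.hodge i).HodgeTypesLE c), D.coeff i :=
  rfl

/-- The coefficient space of an object of weights `≤ w` lies in `W_w`. [folklore] -/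
theorem coeff_le_weightFiltration {i : ι} {w : ℤ} (h : (D.hodge i).WeightsLE w) :
    D.coeff i ≤ D.weightFiltration w :=
  le_iSup₂_of_le (f := fun (i : ι) (_ : (D.hodge i).WeightsLE w) => D.coeff i) i h le_rfl

/-- The coefficient space of an object of Hodge types `≤ c` lies in `C_c`. [folklore] -/
theorem coeff_le_hodgeColevelFiltration {i : ι} {c : ℤ} (h : (D.hodge i).HodgeTypesLE c) :
    D.coeff i ≤ D.hodgeColevelFiltration c :=
  le_iSup₂_of_le (f := fun (i : ι) (_ : (D.hodge i).HodgeTypesLE c) => D.coeff i) i h le_rfl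

/-- The weight filtration is increasing. [folklore] -/
theorem monotone_weightFiltration : Monotone D.weightFiltration :=
  fun _ _ hw => biSup_mono fun _ h => h.mono hw

/-- The Hodge co-level filtration is increasing. [folklore] -/
theorem monotone_hodgeColevelFiltration : Monotone D.hodgeColevelFiltration :=
  fun _ _ hc => biSup_mono fun _ h => h.mono hc

/-- `W_w ≤ T` iff every coefficient space of weights `≤ w` is `≤ T` (how upper bounds on the
weight filtration are proved object by object). [folklore] -/
theorem weightFiltration_le_iff {w : ℤ} {T : Submodule k P} :
    D.weightFiltration w ≤ T ↔ ∀ i, (D.hodge i).WeightsLE w → D.coeff i ≤ T :=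
  iSup₂_le_iff

/-- `C_c ≤ T` iff every coefficient space of Hodge types `≤ c` is `≤ T`. [folklore] -/
theorem hodgeColevelFiltration_le_iff {c : ℤ} {T : Submodule k P} :
    D.hodgeColevelFiltration c ≤ T ↔ ∀ i, (D.hodge i).HodgeTypesLE c → D.coeff i ≤ T :=
  iSup₂_le_iff

/-- Both filtrations live inside the span of all coefficient spaces. [folklore] -/
theorem weightFiltration_le_iSup_coeff (w : ℤ) : D.weightFiltration w ≤ ⨆ i, D.coeff i :=
  iSup₂_le fun i _ => le_iSup D.coeff i

/-- Both filtrations live inside the span of all coefficient spaces. [folklore] -/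
theorem hodgeColevelFiltration_le_iSup_coeff (c : ℤ) :
    D.hodgeColevelFiltration c ≤ ⨆ i, D.coeff i :=
  iSup₂_le fun i _ => le_iSup D.coeff i

variable {D}

/-- **`wt x ≤ w ↔ x ∈ W_w`.** [folklore] -/
theorem weight_le_iff {x : P} {w : ℤ} : D.weight x ≤ (w : WithTop ℤ) ↔ x ∈ D.weightFiltration w :=
  leastIndex_le_coe_iff D.monotone_weightFiltration

/-- **`hodgeColevel x ≤ c ↔ x ∈ C_c`.** [folklore] -/
theorem hodgeColevel_le_iff {x : P} {c : ℤ} :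
    D.hodgeColevel x ≤ (c : WithTop ℤ) ↔ x ∈ D.hodgeColevelFiltration c :=
  leastIndex_le_coe_iff D.monotone_hodgeColevelFiltration

/-- `w ≤ wt x ↔ x ∉ W_{w-1}` (lower bounds on the weight are non-membership statements). [folklore] -/
theorem le_weight_iff {x : P} {w : ℤ} :
    ((w : WithTop ℤ) : WithBot (WithTop ℤ)) ≤ D.weight x ↔ x ∉ D.weightFiltration (w - 1) :=
  coe_le_leastIndex_iff D.monotone_weightFiltration

/-- `c ≤ hodgeColevel x ↔ x ∉ C_{c-1}` (the form of the lower bounds `deg_KZ ≥ L` of route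
`HodgeColevel`: exhibit non-membership in a step of the filtration). [folklore] -/
theorem le_hodgeColevel_iff {x : P} {c : ℤ} :
    ((c : WithTop ℤ) : WithBot (WithTop ℤ)) ≤ D.hodgeColevel x ↔
      x ∉ D.hodgeColevelFiltration (c - 1) :=
  coe_le_leastIndex_iff D.monotone_hodgeColevelFiltration

/-- `wt x = w ↔ x ∈ W_w ∧ x ∉ W_{w-1}`. [folklore] -/
theorem weight_eq_coe_iff {x : P} {w : ℤ} :
    D.weight x = (w : WithTop ℤ) ↔ x ∈ D.weightFiltration w ∧ x ∉ D.weightFiltration (w - 1) :=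
  leastIndex_eq_coe_iff D.monotone_weightFiltration

/-- `hodgeColevel x = c ↔ x ∈ C_c ∧ x ∉ C_{c-1}` (the shape of the exact-degree statements
`PiPowDegree`, `MZVWeightDegree` of route `HodgeColevel`). [folklore] -/
theorem hodgeColevel_eq_coe_iff {x : P} {c : ℤ} :
    D.hodgeColevel x = (c : WithTop ℤ) ↔
      x ∈ D.hodgeColevelFiltration c ∧ x ∉ D.hodgeColevelFiltration (c - 1) :=
  leastIndex_eq_coe_iff D.monotone_hodgeColevelFiltration

/-- The coefficient space of an object of weights `≤ w` has weight `≤ w`. [folklore] -/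
theorem weight_le_of_mem_coeff {i : ι} {w : ℤ} (h : (D.hodge i).WeightsLE w) {x : P}
    (hx : x ∈ D.coeff i) : D.weight x ≤ (w : WithTop ℤ) :=
  weight_le_iff.2 (D.coeff_le_weightFiltration h hx)

/-- The coefficient space of an object of Hodge types `≤ c` has co-level `≤ c`. [folklore] -/
theorem hodgeColevel_le_of_mem_coeff {i : ι} {c : ℤ} (h : (D.hodge i).HodgeTypesLE c) {x : P}
    (hx : x ∈ D.coeff i) : D.hodgeColevel x ≤ (c : WithTop ℤ) :=
  hodgeColevel_le_iff.2 (D.coeff_le_hodgeColevelFiltration h hx)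

/-- `wt 0 = ⊥`, as requested. [folklore] -/
@[simp]
theorem weight_zero : D.weight 0 = ⊥ :=
  leastIndex_zero

/-- `hodgeColevel 0 = ⊥`. [folklore] -/
@[simp]
theorem hodgeColevel_zero : D.hodgeColevel 0 = ⊥ :=
  leastIndex_zero

/-- `wt x = ⊥` iff `x` lies in every `W_w`. [folklore] -/
theorem weight_eq_bot_iff {x : P} : D.weight x = ⊥ ↔ ∀ w, x ∈ D.weightFiltration w :=
  leastIndex_eq_bot_iff D.monotone_weightFiltration

/-- `hodgeColevel x = ⊥` iff `x` lies in every `C_c`. [folklore] -/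
theorem hodgeColevel_eq_bot_iff {x : P} :
    D.hodgeColevel x = ⊥ ↔ ∀ c, x ∈ D.hodgeColevelFiltration c :=
  leastIndex_eq_bot_iff D.monotone_hodgeColevelFiltration

/-- `wt x = ⊤` iff `x` lies in no `W_w`. [folklore] -/
theorem weight_eq_top_iff {x : P} : D.weight x = ⊤ ↔ ∀ w, x ∉ D.weightFiltration w :=
  leastIndex_eq_top_iff

/-- `hodgeColevel x = ⊤` iff `x` lies in no `C_c`. [folklore] -/
theorem hodgeColevel_eq_top_iff {x : P} :
    D.hodgeColevel x = ⊤ ↔ ∀ c, x ∉ D.hodgeColevelFiltration c :=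
  leastIndex_eq_top_iff

/-- Sub-additivity of the weight. [folklore] -/
theorem weight_add_le (x y : P) : D.weight (x + y) ≤ max (D.weight x) (D.weight y) :=
  leastIndex_add_le D.monotone_weightFiltration

/-- Sub-additivity of the Hodge co-level. [folklore] -/
theorem hodgeColevel_add_le (x y : P) :
    D.hodgeColevel (x + y) ≤ max (D.hodgeColevel x) (D.hodgeColevel y) :=
  leastIndex_add_le D.monotone_hodgeColevelFiltration

/-- Scalars do not raise the weight. [folklore] -/
theorem weight_smul_le (a : k) (x : P) : D.weight (a • x) ≤ D.weight x :=
  leastIndex_smul_le a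

/-- Scalars do not raise the Hodge co-level. [folklore] -/
theorem hodgeColevel_smul_le (a : k) (x : P) : D.hodgeColevel (a • x) ≤ D.hodgeColevel x :=
  leastIndex_smul_le a

end HodgePeriodDatum

end Literature.AlgebraicGeometry.Motives

end
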